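import Summits.ResolutionOfSingularities.ResolutionOfSingularities.Theorems.FrobeniusClosingPatchingRelPerfectConeCube
import Summits.ResolutionOfSingularities.ResolutionOfSingularities.Theorems.FrobeniusClosingPatchingRelPerfectConeAdd
import Summits.ResolutionOfSingularities.ResolutionOfSingularities.Theorems.FrobeniusClosingPatchingRelPerfectConeDepthTwoNormalForm
import HarnessLib

/-!
# Crux `PatchingRelPerfect` (stmt-ResolutionOfSingularities-16161), chain w52 — EVERY depth-two
# one-form member over the quadric cone is in the companion class: `(x₀x₁ + x₂² + g) + 𝔪⁴ ∈ 𝒞`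
# for all `g ∈ 𝔪³`

[OURS · L1 W5.2 · rung] The classification of record of this seat's DICHOTOMY-cone-depth-two.md,
now a single kernel theorem.  `S` regular local of dimension four (any characteristic, any residue
field, no completeness), `x₀, …, x₃` a regular system of parameters, `q = x₀x₁ + x₂²` (initial
surface = the quadric CONE in `E ≅ ℙ³`), `g ∈ 𝔪³` ARBITRARY, `I = (q + g) + 𝔪⁴`.  Since
`𝔪³ = (x₀,x₁,x₂)·𝔪² + (x₃³)` (`maximalIdeal_pow_three_le`), `g = p + λx₃³`:

* `λ ∈ 𝔪` — the weight-two-permissible class: `…ConeAdd` (`coreRung_cone_add_sup_pow_four_of_mem_sup`,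
  r2c tower `Bl_𝔪 → Bl_{z₀} → Bl_{C̃} → Bl_{C̃'}`);
* `λ` a unit — CONTACT MIGRATION: by the normal form of `…ConeDepthTwoNormalForm` the member is
  `(y₀y₁ + y₂² + y₃³) + 𝔪⁴` in another regular system of parameters `y`, i.e. the member of
  `…ConeCube` (`coreRung_coneCube_sup_pow_four_of_ringKrullDim`, five-step letter tower).

PROVED: `coreRung_cone_depthTwo_oneForm_of_ringKrullDim` and the registered core's binder shape
`atomDimFourBlowupAt_cone_depthTwo_oneForm`.  Kernel sentence (iii) of CHAIN.md §4 at `ℓ = 2` over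
the cone is therefore TAME in full: non-gradedness and the non-permissible direction are both
handled.  BC5-type FORMAT evidence for the core stub only; nothing here is a statement of the
manuscript under review.

## References

* The Stacks Project, Tags 080A, 080B. [StacksProject]
* Q. Liu, *Algebraic Geometry and Arithmetic Curves*, OUP 2002, Thm. 8.1.19 (a). [Liu2002]
* H. Matsumura, *Commutative Ring Theory*, CUP 1986, Thms. 2.2, 14.2, 16.2. [Matsumura1987]
-/

-- `Summit.<Summit>.<Sub>.Theorems` with `Sub = Summit` (single-conjunct summit, D-0017)
set_option linter.dupNamespace false

noncomputable section

open CategoryTheory CategoryTheory.Limits AlgebraicGeometry Literature.AlgebraicGeometry.Resolution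
open IsLocalRing

namespace Summit.ResolutionOfSingularities.ResolutionOfSingularities.Theorems

namespace ConeRung

universe u

section Classification

variable {S : Type u} [CommRing S] [IsRegularLocalRing S] (x : Fin 4 → S)
  (hx : Ideal.span (Set.range x) = IsLocalRing.maximalIdeal S)

local notation3 "𝔪" => IsLocalRing.maximalIdeal S

include hx in
/-- **`𝔪³ ≤ (x₀, x₁, x₂)·𝔪² + (x₃³)`** — every cubic tail is a weight-two-permissible tail plus
a multiple of `x₃³`. [folklore] -/
theorem maximalIdeal_pow_three_le :
    𝔪 ^ 3 ≤ Ideal.span {x 0, x 1, x 2} * 𝔪 ^ 2 ⊔ Ideal.span {x 3 ^ 3} := by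
  set P : Ideal S := Ideal.span {x 0, x 1, x 2} with hP
  set X : Ideal S := Ideal.span {x 3} with hX
  have hPX : 𝔪 = P ⊔ X := by
    rw [← hx, span_range_four, hP, hX]
    simp only [Ideal.span_insert, sup_assoc]
  have hXle : X ≤ 𝔪 := by
    rw [hX, ← hx, Ideal.span_singleton_le_iff_mem]
    exact Ideal.subset_span ⟨3, rfl⟩
  have hX3 : X * (X * X) = Ideal.span {x 3 ^ 3} := by
    rw [hX, Ideal.span_singleton_mul_span_singleton, Ideal.span_singleton_mul_span_singleton]
    ring_nf
  have hmm : 𝔪 * 𝔪 = P * 𝔪 ⊔ X * 𝔪 := by rw [← Ideal.sup_mul, ← hPX]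
  have hXm : X * 𝔪 = X * P ⊔ X * X := by rw [← Ideal.mul_sup, ← hPX]
  have key : X * (𝔪 * 𝔪) ≤ P * 𝔪 ^ 2 ⊔ Ideal.span {x 3 ^ 3} := by
    rw [hmm, Ideal.mul_sup]
    refine sup_le ?_ ?_
    · rw [mul_left_comm, sq]
      exact le_sup_of_le_left (Ideal.mul_mono_right (Ideal.mul_mono_left hXle))
    · rw [hXm, Ideal.mul_sup]
      refine sup_le ?_ ?_
      · rw [mul_comm X P, mul_left_comm X P X, sq]
        exact le_sup_of_le_left (Ideal.mul_mono_right (Ideal.mul_mono hXle hXle))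
      · rw [hX3]
        exact le_sup_right
  calc 𝔪 ^ 3 = 𝔪 * (𝔪 * 𝔪) := by rw [pow_succ', sq]
    _ = P * (𝔪 * 𝔪) ⊔ X * (𝔪 * 𝔪) := by rw [← Ideal.sup_mul, ← hPX]
    _ ≤ P * 𝔪 ^ 2 ⊔ Ideal.span {x 3 ^ 3} := sup_le (by rw [sq]; exact le_sup_left) key

include hx in
/-- **EVERY DEPTH-TWO ONE-FORM MEMBER OVER THE QUADRIC CONE IS IN `𝒞`.**  For `S` regular local of
dimension four with regular system of parameters `x₀, …, x₃` (every characteristic, every residue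
field), and every `g ∈ 𝔪³`, every blowing up `T = Bl_I Spec S`, `I = (x₀x₁ + x₂² + g) + 𝔪⁴`,
carries a non-zero ideal sheaf cosupported in the closed fibre whose blowing up is regular.
(`g = p + λx₃³`: `λ ∈ 𝔪` → `…ConeAdd`; `λ` a unit → normal form → `…ConeCube`.)
[cite: StacksProject, Tag 080A] [cite: Liu2002, Thm. 8.1.19 (a)] [cite: Matsumura1987, Thm. 2.2] -/
theorem coreRung_cone_depthTwo_oneForm_of_ringKrullDim (hdim : ringKrullDim S = (4 : ℕ))
    (g : S) (hg : g ∈ 𝔪 ^ 3) (T : Scheme.{u}) (f : T ⟶ Spec (.of S))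
    (hf : IsBlowup f (affineBlowup.idealSheaf
      (Ideal.span {x 0 * x 1 + x 2 ^ 2 + g} ⊔ IsLocalRing.maximalIdeal S ^ 4))) :
    ∃ (J : T.IdealSheafData) (T' : Scheme.{u}) (π : T' ⟶ T), J ≠ ⊥ ∧
      (∀ t : T, t ∈ J.support → f.base t = IsLocalRing.closedPoint S) ∧
      IsBlowup π J ∧ Scheme.IsRegular T' := by
  obtain ⟨p, hp, q, hq, hgpq⟩ := Submodule.mem_sup.mp (maximalIdeal_pow_three_le x hx hg)
  obtain ⟨lam, hlamq⟩ := Ideal.mem_span_singleton'.mp hq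
  by_cases hlam : IsUnit lam
  · -- contact migration: change the regular system of parameters
    obtain ⟨y, hy, η, r, hη, hr, hid⟩ := exists_rsop_coneCube_of_isUnit x hx p hp lam hlam
    have e : x 0 * x 1 + x 2 ^ 2 + (p + lam * x 3 ^ 3) =
        η * (y 0 * y 1 + y 2 ^ 2 + y 3 ^ 3) + r := by
      rw [← hid]; ring
    rw [← hgpq, ← hlamq, e, span_singleton_add_sup_of_mem _ _ hr,
      Ideal.span_singleton_mul_left_unit hη] at hf
    exact coreRung_coneCube_sup_pow_four_of_ringKrullDim y hy hdim T f hf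
  · -- weight-two-permissible: `λ x₃³ ∈ 𝔪⁴`
    have hlm : lam ∈ 𝔪 := hlam
    have hx3 : x 3 ∈ 𝔪 := hx ▸ Ideal.subset_span ⟨3, rfl⟩
    have hg' : g ∈ Ideal.span {x 0, x 1, x 2} * 𝔪 ^ 2 ⊔ 𝔪 ^ 4 := by
      rw [← hgpq, ← hlamq]
      refine Ideal.add_mem _ (Ideal.mem_sup_left hp) (Ideal.mem_sup_right ?_)
      rw [pow_succ']
      exact Ideal.mul_mem_mul hlm (Ideal.pow_mem_pow hx3 3)
    exact coreRung_cone_add_sup_pow_four_of_mem_sup x hx hdim g hg' T f hf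

end Classification

/-- **The registered core's binder shape, restricted to the class** (hypotheses of
`stub_atomDimFourBlowup`; characteristic, completeness, residue field and the off-fibre hypothesis
unused): every depth-two one-form member over the quadric cone.
[cite: StacksProject, Tag 080A] [cite: Liu2002, Thm. 8.1.19 (a)] -/
theorem atomDimFourBlowupAt_cone_depthTwo_oneForm (p : ℕ) (_hp : p.Prime) (S : Type) [CommRing S]
    [IsRegularLocalRing S] [CharP S p] [IsAdicComplete (IsLocalRing.maximalIdeal S) S]
    [PerfectField (IsLocalRing.ResidueField S)] (hS : ringKrullDim S = (4 : ℕ))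
    (x : Fin 4 → S) (hx : Ideal.span (Set.range x) = IsLocalRing.maximalIdeal S)
    (g : S) (hg : g ∈ IsLocalRing.maximalIdeal S ^ 3)
    (T : Scheme.{0}) (f : T ⟶ Spec (.of S))
    (hf : IsBlowup f (affineBlowup.idealSheaf
      (Ideal.span {x 0 * x 1 + x 2 ^ 2 + g} ⊔ IsLocalRing.maximalIdeal S ^ 4)))
    (_hoff : ∀ t : T, f.base t ≠ IsLocalRing.closedPoint S →
      IsRegularLocalRing (T.presheaf.stalk t)) :
    ∃ (J : T.IdealSheafData) (T' : Scheme.{0}) (π : T' ⟶ T), J ≠ ⊥ ∧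
      (∀ t : T, t ∈ J.support → f.base t = IsLocalRing.closedPoint S) ∧
      IsBlowup π J ∧ Scheme.IsRegular T' :=
  coreRung_cone_depthTwo_oneForm_of_ringKrullDim x hx hS g hg T f hf

end ConeRung

end Summit.ResolutionOfSingularities.ResolutionOfSingularities.Theorems

end
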